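import Literature.Probability.Percolation.TwoClusterConditionalAssociationProofs
import Literature.Probability.LatticeModels.ProdBernoulliIndependence
import Literature.Probability.LatticeModels.ProdBernoulliClusterLocality
import Summits.CriticalPhenomena.PercolationContinuityZ3.Theorems.PercNearOneGluingNoHeavyLowerTailOneLayerTwoFingerTools
import HarnessLib

/-!
# The pivotality law `P(a|b|h) · P(h pivotal for a↔b) ≤ P(ah|b) · P(bh|a)` — preliminaries (walks, cells, conditioning)

Support file for crux `stmt-CriticalPhenomena-4575` (`NoHeavyLowerTail`), seat `prim-l12-p1` gen 21
(`--supports stmt-CriticalPhenomena-4575`).  Memo `run/shared/lean/prim/prim-l12/FROM-prim-l12-p1-g21-SEXTIC-ISOLATION-LAW.md` §3b.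

Bond percolation `μ = prodBernoulli w` with arbitrary pair weights on a finite vertex type, distinct vertices `a b h`.
Write `H` for the pairs containing `h`, `ω ∖ H` for the configuration with the pairs at `h` removed, and call `h`
PIVOTAL for `a ↔ b` in `ω` when `a ↔ b` in `ω` but not in `ω ∖ H`.  THEOREM (`sep_mul_pivotal_le`, in the sequel file `…ThreePointPivotalBHK`) [this work]:

  `P(a, b, h pairwise separated) · P(h pivotal for a↔b) ≤ P(a↔h, a↮b) · P(b↔h, a↮b)`,

i.e. `q · piv ≤ t · u` in the cells of the three-point law of `(a, b, h)`.  Proof: condition on `x = ω ∖ H`; on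
`{a ↮ b in x}` the four events are `{x} × (±Hit_a) × (±Hit_b)` where `Hit_a` = "some open pair at `h` meets the
`x`-cluster of `a`" (last-edge decomposition of an open `a–h` path, `SimpleGraph.Walk.exists_boundary_dart`), the two
hit events are determined by DISJOINT sets of pairs at `h` (the clusters are disjoint), hence independent of each other
and of `x` (`prodBernoulli_real_inter_of_determinedBy_disjoint`); so `q, piv, t, u` are the `m`-averages of
`(1−α)(1−β), αβ, α(1−β), (1−α)β` for the hitting probabilities `α(x), β(x)` and the measure `m = law of x restricted to
{a ↮ b in x}`, and `t u − q·piv = (∫α dm)(∫β dm) − m(1)·∫αβ dm ≥ 0` is EXACTLY van den Berg–Häggström–Kahn 2006,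
Thm. 1.4 (`BHK2006_twoClusterConditionalAssociation_holds`, `.negCorrelation`, both in the tree) for the percolation
with the pairs at `h` closed (`w₀`), applied to the increasing cluster functions `C ↦ P(Hit of the vertex set of C)`.
This is the BHK step of the memo's reduction of the covariance law `(C_λ)` to `(R_λ)`.
THIS FILE: the walk lemmas (last-edge decomposition, pivotality), the cell identities `cells_eq`, and the conditioning
lemmas `real_offStar_inter_hits`, `real_eq_sum_offStar`.
-/

namespace Summit.CriticalPhenomena.PercolationContinuityZ3.Theorems.ThreePointPivotalBHK

open MeasureTheory Set
open Literature.Probability.Percolation Literature.Probability.LatticeModels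
open scoped Classical

variable {V : Type*} [Fintype V] [DecidableEq V]

/-! ## Combinatorics: open paths to `h` and the configuration off the star of `h` -/

section Walks

variable {h : V} {ω : BondConfig V}

/-- The pairs NOT containing `h` that are open in `ω`: the configuration off the star of `h`. [this work] -/
theorem mem_sdiff_star_iff (ω : BondConfig V) (h : V) (e : Sym2 V) :
    e ∈ ω \ ↑(Finset.univ.filter fun e : Sym2 V => h ∈ e) ↔ e ∈ ω ∧ h ∉ e := by
  simp

/-- Reachability off the star of `h` implies reachability. [this work] -/
theorem reachable_of_sdiff {u v : V} (huv : (openGraph (ω \ ↑(Finset.univ.filter fun e : Sym2 V => h ∈ e))).Reachable u v) :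
    (openGraph ω).Reachable u v :=
  huv.mono (openGraph_mono fun _ he => he.1)

/-- `h` is isolated off its own star: `u ↔ h` off the star forces `u = h`. [this work] -/
theorem eq_of_reachable_sdiff_h {u : V} (hu : (openGraph (ω \ ↑(Finset.univ.filter fun e : Sym2 V => h ∈ e))).Reachable u h) :
    u = h := by
  by_contra hne
  obtain ⟨p⟩ := hu
  obtain ⟨d, -, hd1, hd2⟩ := p.exists_boundary_dart {v | v ≠ h} hne (by simp)
  have hadj := d.adj
  rw [openGraph_adj] at hadj
  have hmem := (mem_sdiff_star_iff ω h _).1 hadj.1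
  simp only [mem_setOf_eq, not_not] at hd2
  exact hmem.2 (by rw [hd2]; exact Sym2.mem_mk_right _ _)

/-- **Last-edge decomposition**: if `a ↔ h` in `ω` (`a ≠ h`) then some open pair `s(h, v)`, `v ≠ h`, has `v` in the
cluster of `a` OFF the star of `h`. [this work] -/
theorem exists_hit_of_reachable {a : V} (hah : a ≠ h) (hreach : (openGraph ω).Reachable a h) :
    ∃ v, v ≠ h ∧ s(h, v) ∈ ω ∧ (openGraph (ω \ ↑(Finset.univ.filter fun e : Sym2 V => h ∈ e))).Reachable a v := by
  set x := ω \ ↑(Finset.univ.filter fun e : Sym2 V => h ∈ e) with hx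
  obtain ⟨p⟩ := hreach
  set T : Set V := {v | (openGraph x).Reachable a v} with hT
  have haT : a ∈ T := SimpleGraph.Reachable.refl a
  have hhT : h ∉ T := by
    intro hh
    have hh' : (openGraph x).Reachable a h := hh
    exact hah (eq_of_reachable_sdiff_h hh')
  obtain ⟨d, -, hd1, hd2⟩ := p.exists_boundary_dart T haT hhT
  have hadj := d.adj
  rw [openGraph_adj] at hadj
  -- the boundary pair contains `h` (otherwise it is open off the star and extends the `x`-cluster of `a`)
  have hh : h ∈ s(d.toProd.1, d.toProd.2) := by
    by_contra hnot
    have hex : s(d.toProd.1, d.toProd.2) ∈ x := (mem_sdiff_star_iff ω h _).2 ⟨hadj.1, hnot⟩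
    exact hd2 (SimpleGraph.Reachable.trans hd1 ⟨SimpleGraph.Walk.cons ((openGraph_adj x _ _).2 ⟨hex, hadj.2⟩) SimpleGraph.Walk.nil⟩)
  have h2 : d.toProd.2 = h := by
    rcases Sym2.mem_iff.1 hh with h1 | h2
    · exact (hhT (by rw [h1]; exact hd1)).elim
    · exact h2.symm
  refine ⟨d.toProd.1, fun h1 => hhT (h1 ▸ hd1), ?_, hd1⟩
  rw [Sym2.eq_swap, ← h2]; exact hadj.1

/-- Conversely an open pair `s(h,v)` with `v` in the off-star cluster of `a` joins `a` to `h`. [this work] -/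
theorem reachable_of_hit {a v : V} (hv : s(h, v) ∈ ω) (hvh : v ≠ h)
    (hav : (openGraph (ω \ ↑(Finset.univ.filter fun e : Sym2 V => h ∈ e))).Reachable a v) :
    (openGraph ω).Reachable a h :=
  (reachable_of_sdiff hav).trans ⟨SimpleGraph.Walk.cons ((openGraph_adj ω v h).2 ⟨by rw [Sym2.eq_swap]; exact hv, hvh⟩) SimpleGraph.Walk.nil⟩

/-- **Pivotality**: if `a ↔ b` in `ω` but not off the star of `h`, then `a ↔ h` (and, symmetrically, `b ↔ h`). [this work] -/
theorem reachable_h_of_pivotal {a b : V}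
    (hab : (openGraph ω).Reachable a b) (hx : ¬ (openGraph (ω \ ↑(Finset.univ.filter fun e : Sym2 V => h ∈ e))).Reachable a b) :
    (openGraph ω).Reachable a h := by
  set x := ω \ ↑(Finset.univ.filter fun e : Sym2 V => h ∈ e) with hxdef
  obtain ⟨p⟩ := hab
  set T : Set V := {v | (openGraph x).Reachable a v} with hT
  obtain ⟨d, -, hd1, hd2⟩ := p.exists_boundary_dart T (SimpleGraph.Reachable.refl a) hx
  have hadj := d.adj
  rw [openGraph_adj] at hadj
  have hh : h ∈ s(d.toProd.1, d.toProd.2) := by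
    by_contra hnot
    have hex : s(d.toProd.1, d.toProd.2) ∈ x := (mem_sdiff_star_iff ω h _).2 ⟨hadj.1, hnot⟩
    exact hd2 (SimpleGraph.Reachable.trans hd1 ⟨SimpleGraph.Walk.cons ((openGraph_adj x _ _).2 ⟨hex, hadj.2⟩) SimpleGraph.Walk.nil⟩)
  rcases Sym2.mem_iff.1 hh with h1 | h2
  · -- `d.fst = h`: then `a ↔ h` off the star, so `a = h`... but then `a ↔ h` trivially
    have := hd1; rw [← h1] at this; exact reachable_of_sdiff this
  · have hreach : (openGraph ω).Reachable a d.toProd.1 := reachable_of_sdiff hd1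
    exact hreach.trans ⟨SimpleGraph.Walk.cons ((openGraph_adj ω _ _).2 ⟨hadj.1, hadj.2⟩) (h2 ▸ SimpleGraph.Walk.nil)⟩

end Walks


/-! ## Events: the four cells through the off-star configuration and the two hit events -/

section Cells

variable (a b h : V)

/-- `a ↔ h` is the hit event of the off-star cluster of `a` (for `a ≠ h`). [this work] -/
theorem openConn_h_eq_hit (hah : a ≠ h) :
    (openConn a h : Set (BondConfig V)) =
      {ω | ∃ v, v ≠ h ∧ s(h, v) ∈ ω ∧ (openGraph (ω \ ↑(Finset.univ.filter fun e : Sym2 V => h ∈ e))).Reachable a v} := by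
  ext ω
  exact ⟨fun hr => exists_hit_of_reachable hah hr, fun ⟨v, hvh, hv, hav⟩ => reachable_of_hit hv hvh hav⟩

/-- The three-point cells of `(a, b, h)` in terms of `N = {a ↮ b off the star of h}` and the two hit events
`A = {a ↔ h}`, `B = {b ↔ h}`:  `a|b|h = N ∩ Aᶜ ∩ Bᶜ`, `pivotal = N ∩ A ∩ B`, `ah|b = N ∩ A ∩ Bᶜ`, `bh|a = N ∩ Aᶜ ∩ B`. [this work] -/
theorem cells_eq :
    ((openConn a b)ᶜ ∩ (openConn a h)ᶜ ∩ (openConn b h)ᶜ : Set (BondConfig V)) =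
        {ω | ¬ (openGraph (ω \ ↑(Finset.univ.filter fun e : Sym2 V => h ∈ e))).Reachable a b} ∩ (openConn a h)ᶜ ∩ (openConn b h)ᶜ ∧
      (openConn a b ∩ {ω | ¬ (openGraph (ω \ ↑(Finset.univ.filter fun e : Sym2 V => h ∈ e))).Reachable a b} : Set (BondConfig V)) =
        {ω | ¬ (openGraph (ω \ ↑(Finset.univ.filter fun e : Sym2 V => h ∈ e))).Reachable a b} ∩ openConn a h ∩ openConn b h ∧
      (openConn a h ∩ (openConn a b)ᶜ : Set (BondConfig V)) =
        {ω | ¬ (openGraph (ω \ ↑(Finset.univ.filter fun e : Sym2 V => h ∈ e))).Reachable a b} ∩ openConn a h ∩ (openConn b h)ᶜ ∧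
      (openConn b h ∩ (openConn a b)ᶜ : Set (BondConfig V)) =
        {ω | ¬ (openGraph (ω \ ↑(Finset.univ.filter fun e : Sym2 V => h ∈ e))).Reachable a b} ∩ (openConn a h)ᶜ ∩ openConn b h := by
  have key : ∀ ω : BondConfig V, ω ∈ openConn a b ↔
      ((openGraph (ω \ ↑(Finset.univ.filter fun e : Sym2 V => h ∈ e))).Reachable a b ∨ (ω ∈ openConn a h ∧ ω ∈ openConn b h)) := by
    intro ω
    constructor
    · intro hr
      by_cases hx : (openGraph (ω \ ↑(Finset.univ.filter fun e : Sym2 V => h ∈ e))).Reachable a b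
      · exact Or.inl hx
      · refine Or.inr ⟨reachable_h_of_pivotal hr hx, ?_⟩
        have hr' : (openGraph ω).Reachable b a := SimpleGraph.Reachable.symm hr
        have hx' : ¬ (openGraph (ω \ ↑(Finset.univ.filter fun e : Sym2 V => h ∈ e))).Reachable b a :=
          fun h' => hx (SimpleGraph.Reachable.symm h')
        exact reachable_h_of_pivotal hr' hx'
    · rintro (hx | ⟨h1, h2⟩)
      · exact reachable_of_sdiff hx
      · exact SimpleGraph.Reachable.trans h1 (SimpleGraph.Reachable.symm h2)
  refine ⟨?_, ?_, ?_, ?_⟩ <;> ext ω <;> simp only [mem_inter_iff, mem_compl_iff, mem_setOf_eq, key ω] <;> tauto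

end Cells

/-! ## Measure theory: conditioning on the off-star configuration -/

section Measure

variable (w : Sym2 V → unitInterval) (h : V)

omit [Fintype V] in
/-- The hit event of a vertex set `S` (not containing `h`) is determined by the pairs `s(h, v)`, `v ∈ S`. [this work] -/
theorem determinedBy_hit (S : Finset V) :
    DeterminedBy {ω : BondConfig V | ∃ v ∈ S, s(h, v) ∈ ω} (↑(S.image fun v => s(h, v)) : Set (Sym2 V)) := by
  rw [determinedBy_iff]
  intro ω ω' hωω'
  simp only [mem_setOf_eq]
  constructor
  · rintro ⟨v, hvS, hv⟩
    have hm : s(h, v) ∈ ω ∩ ↑(S.image fun v => s(h, v)) := ⟨hv, Finset.mem_coe.2 (Finset.mem_image_of_mem _ hvS)⟩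
    rw [hωω'] at hm
    exact ⟨v, hvS, hm.1⟩
  · rintro ⟨v, hvS, hv⟩
    have hm : s(h, v) ∈ ω' ∩ ↑(S.image fun v => s(h, v)) := ⟨hv, Finset.mem_coe.2 (Finset.mem_image_of_mem _ hvS)⟩
    rw [← hωω'] at hm
    exact ⟨v, hvS, hm.1⟩

/-- The event "the off-star configuration is `x`" is determined by the pairs off the star. [this work] -/
theorem determinedBy_offStar_eq (x : BondConfig V) :
    DeterminedBy {ω : BondConfig V | ω \ ↑(Finset.univ.filter fun e : Sym2 V => h ∈ e) = x}
      (↑(Finset.univ \ Finset.univ.filter fun e : Sym2 V => h ∈ e) : Set (Sym2 V)) := by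
  rw [determinedBy_iff]
  intro ω ω' hωω'
  have e1 : ω \ ↑(Finset.univ.filter fun e : Sym2 V => h ∈ e) = ω ∩ ↑(Finset.univ \ Finset.univ.filter fun e : Sym2 V => h ∈ e) := by
    ext e; simp
  have e2 : ω' \ ↑(Finset.univ.filter fun e : Sym2 V => h ∈ e) = ω' ∩ ↑(Finset.univ \ Finset.univ.filter fun e : Sym2 V => h ∈ e) := by
    ext e; simp
  simp only [mem_setOf_eq, e1, e2, hωω']

omit [Fintype V] in
/-- Hit sets of disjoint vertex sets avoiding `h` use disjoint pairs. [this work] -/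
theorem disjoint_hitPairs {S T : Finset V} (hST : Disjoint S T) (hS : h ∉ S) :
    Disjoint (S.image fun v => s(h, v)) (T.image fun v => s(h, v)) := by
  rw [Finset.disjoint_left]
  intro e heS heT
  obtain ⟨v, hvS, rfl⟩ := Finset.mem_image.1 heS
  obtain ⟨v', hvT, hvv'⟩ := Finset.mem_image.1 heT
  rcases Sym2.eq_iff.1 hvv' with ⟨-, h2⟩ | ⟨h1, -⟩
  · exact Finset.disjoint_left.1 hST hvS (by rw [← h2]; exact hvT)
  · exact hS (by rw [h1]; exact hvS)

/-- The hit pairs lie inside the star of `h`, hence are disjoint from the pairs off the star. [this work] -/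
theorem disjoint_offStar_hitPairs (S : Finset V) :
    Disjoint (Finset.univ \ Finset.univ.filter fun e : Sym2 V => h ∈ e) (S.image fun v => s(h, v)) := by
  rw [Finset.disjoint_left]
  intro e he heS
  obtain ⟨v, -, rfl⟩ := Finset.mem_image.1 heS
  simp at he

/-- **Conditioning on the off-star configuration**: for a fixed off-star value `x` and disjoint vertex sets `S, T ∌ h`,
`P(ω∖H = x, Hit_S^{±}, Hit_T^{±}) = P(ω∖H = x) · P(Hit_S^{±}) · P(Hit_T^{±})`. [this work] -/
theorem real_offStar_inter_hits (x : BondConfig V) {S T : Finset V} (hST : Disjoint S T) (hS : h ∉ S)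
    (A B : Set (BondConfig V))
    (hA : A = {ω | ∃ v ∈ S, s(h, v) ∈ ω} ∨ A = {ω | ∃ v ∈ S, s(h, v) ∈ ω}ᶜ)
    (hB : B = {ω | ∃ v ∈ T, s(h, v) ∈ ω} ∨ B = {ω | ∃ v ∈ T, s(h, v) ∈ ω}ᶜ) :
    (prodBernoulli w).real ({ω | ω \ ↑(Finset.univ.filter fun e : Sym2 V => h ∈ e) = x} ∩ (A ∩ B)) =
      (prodBernoulli w).real {ω | ω \ ↑(Finset.univ.filter fun e : Sym2 V => h ∈ e) = x} *
        ((prodBernoulli w).real A * (prodBernoulli w).real B) := by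
  have hAd : DeterminedBy A (↑(S.image fun v => s(h, v)) : Set (Sym2 V)) := by
    rcases hA with rfl | rfl
    · exact determinedBy_hit h S
    · exact OneLayerTwoFinger.determinedBy_compl (determinedBy_hit h S)
  have hBd : DeterminedBy B (↑(T.image fun v => s(h, v)) : Set (Sym2 V)) := by
    rcases hB with rfl | rfl
    · exact determinedBy_hit h T
    · exact OneLayerTwoFinger.determinedBy_compl (determinedBy_hit h T)
  have hABd : DeterminedBy (A ∩ B) (↑((S.image fun v => s(h, v)) ∪ (T.image fun v => s(h, v))) : Set (Sym2 V)) := by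
    rw [Finset.coe_union]
    exact DeterminedBy.inter (hAd.mono subset_union_left) (hBd.mono subset_union_right)
  have hdisj1 : Disjoint (Finset.univ \ Finset.univ.filter fun e : Sym2 V => h ∈ e)
      ((S.image fun v => s(h, v)) ∪ (T.image fun v => s(h, v))) :=
    Finset.disjoint_union_right.2 ⟨disjoint_offStar_hitPairs h S, disjoint_offStar_hitPairs h T⟩
  rw [prodBernoulli_real_inter_of_determinedBy_disjoint w hdisj1 (determinedBy_offStar_eq h x) hABd
      MeasurableSet.of_discrete MeasurableSet.of_discrete,
    prodBernoulli_real_inter_of_determinedBy_disjoint w (disjoint_hitPairs h hST hS) hAd hBd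
      MeasurableSet.of_discrete MeasurableSet.of_discrete]

/-- **Total probability over the off-star configuration**: `P(E) = Σ_x P(ω∖H = x, E)`. [this work] -/
theorem real_eq_sum_offStar (E : Set (BondConfig V)) :
    (prodBernoulli w).real E =
      ∑ x : BondConfig V, (prodBernoulli w).real ({ω | ω \ ↑(Finset.univ.filter fun e : Sym2 V => h ∈ e) = x} ∩ E) := by
  have hE : E = ⋃ x ∈ (Finset.univ : Finset (BondConfig V)),
      ({ω | ω \ ↑(Finset.univ.filter fun e : Sym2 V => h ∈ e) = x} ∩ E) := by
    ext ω; simp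
  conv_lhs => rw [hE]
  rw [measureReal_biUnion_finset]
  · intro x _ y _ hxy
    exact Set.disjoint_left.2 fun ω h1 h2 => hxy (h1.1.symm.trans h2.1)
  · intro _ _; exact MeasurableSet.of_discrete

end Measure


end Summit.CriticalPhenomena.PercolationContinuityZ3.Theorems.ThreePointPivotalBHK
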